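import Literature.Topology.FourManifolds.MilnorBoxReverse
import Literature.Topology.FourManifolds.MilnorFlowSymmetry
import HarnessLib

/-!
# Twisting a Milnor box by a linear symmetry of the model

Topic `Literature/Topology/FourManifolds` (support file for the two-field handle-extension
endgame of `stmt-SmoothPoincare4-15190`; companion of `MilnorBoxReverse.lean`).
Everything here is **proved**; no named facts.

Milnor, *Lectures on the h-cobordism theorem* (1965), Def. 3.1 (2) (PDF p. 12): about a
critical point `q` of index `k` there are coordinates `u = φ̂ - φ̂ q` with
`f = f q - |x⃗|² + |y⃗|²` and `ξ = (-x⃗, y⃗)` — a **Milnor box**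
`Literature.Topology.FourManifolds.MilnorBox J f X q` (`GradientLikeDynamics.lean`).  Such
coordinates are not unique: composing with any **linear isometry `S` of `ℝᵐ` commuting with the
model field `F_k`** (for `k = 1`, `m = 3`: `S = diag(±1, R)`, `R ∈ O(2)`) gives Milnor
coordinates again, since `Q_k ∘ S = Q_k` and `S ∘ F_k = F_k ∘ S`
(`MilnorFlowSymmetry.lean`).  Following the pattern of `MilnorBox.reverse`
(`MilnorBoxReverse.lean`, the case `S = coordRev`), we build

* `MilnorBox.twistAffine D S : u ↦ S (u - u₀) + u₀`, `MilnorBox.twistChart D S = φ ≫ (twistAffine)`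
  conjugated into the model space `H` through `J` (`OpenPartialHomeomorph.conjModel`,
  `SliceCharts.lean`), a member of the maximal atlas;
* `MilnorBox.twist D S hS hint : MilnorBox J f X q` — **the twisted box**: same index, same size,
  centred coordinates `S (φ̂ z - φ̂ q)` (`coord_twist`) and chart points `ψ'(w) = ψ(S⁻¹ w)`
  (`twist_symm_add`), under the interiority hypothesis `hint` (the closed `3ε`-ball about `u₀`
  lies in the interior of `range J`, automatic at interior critical points after shrinking).

These twisted boxes are how a boundary diffeomorphism that is *rigid* near the belt circle of a
`1`-handle — a model symmetry `S` in flow-polar coordinates — is matched with the identity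
chart map between the box at one saddle and the twisted box at another.

## References

* J. Milnor, *Lectures on the h-cobordism theorem*, notes by L. Siebenmann and J. Sondow (1965),
  Def. 3.1 (PDF p. 12). [MilnorHCobordism1965]
-/

open scoped Manifold ContDiff Topology
open Set Function Filter Metric

noncomputable section

namespace Literature.Topology.FourManifolds

universe u

namespace MilnorBox

variable {m : ℕ} {H : Type*} [TopologicalSpace H] {J : ModelWithCorners ℝ (EuclideanSpace ℝ (Fin m)) H}
  {M : Type u} [TopologicalSpace M] [ChartedSpace H M]
  {f : M → ℝ} {X : Π x : M, TangentSpace J x} {q : M} (D : MilnorBox J f X q)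
  (S : EuclideanSpace ℝ (Fin m) ≃ₗᵢ[ℝ] EuclideanSpace ℝ (Fin m))

/-! ### The affine twist about the centre -/

/-- **The affine twist `u ↦ S (u - u₀) + u₀` about the centre**, a homeomorphism of `ℝᵐ`. [cite: MilnorHCobordism1965, Def. 3.1 (PDF p. 12)] -/
def twistAffine : EuclideanSpace ℝ (Fin m) ≃ₜ EuclideanSpace ℝ (Fin m) :=
  ((Homeomorph.addRight (-D.center)).trans S.toHomeomorph).trans (Homeomorph.addRight D.center)

/-- The affine twist evaluated. [folklore] -/
theorem twistAffine_apply (u : EuclideanSpace ℝ (Fin m)) : D.twistAffine S u = S (u - D.center) + D.center := by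
  simp [twistAffine, sub_eq_add_neg]

/-- The inverse affine twist evaluated. [folklore] -/
theorem twistAffine_symm_apply (u : EuclideanSpace ℝ (Fin m)) :
    (D.twistAffine S).symm u = S.symm (u - D.center) + D.center := by
  rw [Homeomorph.symm_apply_eq, twistAffine_apply]
  simp

/-- The affine twist on `u₀ + w`. [folklore] -/
theorem twistAffine_center_add (w : EuclideanSpace ℝ (Fin m)) :
    D.twistAffine S (D.center + w) = D.center + S w := by
  rw [twistAffine_apply, add_sub_cancel_left, add_comm]

/-- The affine twist fixes the centre. [folklore] -/
theorem twistAffine_center : D.twistAffine S D.center = D.center := by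
  have h := D.twistAffine_center_add S 0
  rwa [map_zero, add_zero] at h

/-- The affine twist preserves the distance to the centre. [folklore] -/
theorem dist_twistAffine_center (u : EuclideanSpace ℝ (Fin m)) :
    dist (D.twistAffine S u) D.center = dist u D.center := by
  rw [twistAffine_apply, dist_eq_norm, dist_eq_norm, add_sub_cancel_right, LinearIsometryEquiv.norm_map]

/-- The affine twist as an open partial homeomorphism of `ℝᵐ` (source and target `univ`). [folklore] -/
def twistModel : OpenPartialHomeomorph (EuclideanSpace ℝ (Fin m)) (EuclideanSpace ℝ (Fin m)) :=
  (D.twistAffine S).toOpenPartialHomeomorph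

/-- `twistModel` as a function. [folklore] -/
@[simp] theorem twistModel_apply (u : EuclideanSpace ℝ (Fin m)) : D.twistModel S u = D.twistAffine S u := rfl

/-- The inverse of `twistModel` as a function. [folklore] -/
@[simp] theorem twistModel_symm_apply (u : EuclideanSpace ℝ (Fin m)) :
    (D.twistModel S).symm u = (D.twistAffine S).symm u := rfl

/-- The source of `twistModel` is everything. [folklore] -/
@[simp] theorem twistModel_source : (D.twistModel S).source = univ := rfl

/-- The target of `twistModel` is everything. [folklore] -/
@[simp] theorem twistModel_target : (D.twistModel S).target = univ := rfl

/-- The affine twist is smooth. [folklore] -/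
theorem contDiff_twistAffine : ContDiff ℝ ∞ (D.twistAffine S) := by
  rw [show (D.twistAffine S : EuclideanSpace ℝ (Fin m) → EuclideanSpace ℝ (Fin m)) =
      fun u => S (u - D.center) + D.center from funext (D.twistAffine_apply S)]
  exact (S.toContinuousLinearEquiv.contDiff.comp (contDiff_id.sub contDiff_const)).add contDiff_const

/-- The inverse affine twist is smooth. [folklore] -/
theorem contDiff_twistAffine_symm : ContDiff ℝ ∞ (D.twistAffine S).symm := by
  rw [show ((D.twistAffine S).symm : EuclideanSpace ℝ (Fin m) → EuclideanSpace ℝ (Fin m)) =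
      fun u => S.symm (u - D.center) + D.center from funext (D.twistAffine_symm_apply S)]
  exact (S.symm.toContinuousLinearEquiv.contDiff.comp (contDiff_id.sub contDiff_const)).add
    contDiff_const

/-- `conjModel J twistModel` is a smooth change of coordinates. [folklore] -/
theorem conjModel_twistModel_mem : (D.twistModel S).conjModel J ∈ contDiffGroupoid ∞ J :=
  OpenPartialHomeomorph.conjModel_mem_contDiffGroupoid (D.contDiff_twistAffine S).contDiffOn
    (D.contDiff_twistAffine_symm S).contDiffOn

/-! ### The twisted chart -/

/-- **The twisted chart** `φ ≫ (u ↦ S (u - u₀) + u₀)` (conjugated into the model space). [cite: MilnorHCobordism1965, Def. 3.1 (PDF p. 12)] -/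
def twistChart : OpenPartialHomeomorph M H := D.chart ≫ₕ (D.twistModel S).conjModel J

/-- The twisted chart belongs to the maximal atlas. [folklore] -/
theorem twistChart_mem_maximalAtlas : D.twistChart S ∈ IsManifold.maximalAtlas J ∞ M :=
  StructureGroupoid.trans_mem_maximalAtlas (contDiffGroupoid ∞ J) D.mem_maximalAtlas
    (D.conjModel_twistModel_mem S)

/-- Membership in the source of the twisted chart. [folklore] -/
theorem mem_twistChart_source {z : M} : z ∈ (D.twistChart S).source ↔ z ∈ D.chart.source ∧
    D.chart.extend J z ∈ interior (range J) ∧ D.twistAffine S (D.chart.extend J z) ∈ interior (range J) := by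
  rw [twistChart, OpenPartialHomeomorph.trans_source, mem_inter_iff, mem_preimage,
    OpenPartialHomeomorph.mem_conjModel_source, twistModel_source]
  simp only [mem_univ, true_and, twistModel_apply]
  rfl

/-- The source of the twisted chart lies in the source of the chart. [folklore] -/
theorem twistChart_source_subset : (D.twistChart S).source ⊆ D.chart.source := fun _ hz =>
  ((D.mem_twistChart_source S).1 hz).1

/-- **The twisted coordinates are the affine twist of the old ones** on the source. [cite: MilnorHCobordism1965, Def. 3.1 (PDF p. 12)] -/
theorem twistChart_extend {z : M} (hz : z ∈ (D.twistChart S).source) :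
    (D.twistChart S).extend J z = D.twistAffine S (D.chart.extend J z) := by
  have hz' : D.chart z ∈ ((D.twistModel S).conjModel J).source := by
    rw [twistChart, OpenPartialHomeomorph.trans_source] at hz
    exact hz.2
  rw [OpenPartialHomeomorph.extend_coe, comp_apply, twistChart, OpenPartialHomeomorph.coe_trans, comp_apply,
    OpenPartialHomeomorph.apply_conjModel_of_mem_source hz', twistModel_apply]
  rfl

/-- The twisted coordinates, centred: `φ̂' z - u₀ = S (φ̂ z - u₀)`. [cite: MilnorHCobordism1965, Def. 3.1 (PDF p. 12)] -/
theorem twistChart_extend_sub_center {z : M} (hz : z ∈ (D.twistChart S).source) :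
    (D.twistChart S).extend J z - D.center = S (D.coord z) := by
  rw [D.twistChart_extend S hz, twistAffine_apply, add_sub_cancel_right]
  rfl

section Interior

variable (hint : closedBall (D.chart.extend J q) (3 * D.ε) ⊆ interior (range J))
include hint

/-- Under `hint`, the chart points `ψ w`, `‖w‖ ≤ 3ε`, lie in the source of the twisted chart. [folklore] -/
theorem symm_add_mem_twistChart_source {w : EuclideanSpace ℝ (Fin m)} (hw : ‖w‖ ≤ 3 * D.ε) :
    (D.chart.extend J).symm (D.center + w) ∈ (D.twistChart S).source := by
  have h1 : D.chart.extend J ((D.chart.extend J).symm (D.center + w)) = D.center + w :=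
    (D.chart.extend J).right_inv (D.add_mem_target_of_norm_le hw)
  refine (D.mem_twistChart_source S).2 ⟨D.symm_add_mem_source hw, ?_, ?_⟩
  · rw [h1]
    refine hint (mem_closedBall.2 ?_)
    show dist (D.chart.extend J q + w) (D.chart.extend J q) ≤ 3 * D.ε
    rwa [dist_eq_norm, add_sub_cancel_left]
  · rw [h1, twistAffine_center_add]
    refine hint (mem_closedBall.2 ?_)
    show dist (D.chart.extend J q + S w) (D.chart.extend J q) ≤ 3 * D.ε
    rwa [dist_eq_norm, add_sub_cancel_left, LinearIsometryEquiv.norm_map]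

/-- Under `hint`, the critical point lies in the source of the twisted chart. [folklore] -/
theorem mem_twistChart_source_self : q ∈ (D.twistChart S).source := by
  have h := D.symm_add_mem_twistChart_source S hint (w := 0) (by rw [norm_zero]; linarith [D.eps_pos])
  rwa [D.symm_add_zero] at h

/-- **The twisted coordinates of `ψ w` are `u₀ + S w`** (`‖w‖ ≤ 3ε`). [cite: MilnorHCobordism1965, Def. 3.1 (PDF p. 12)] -/
theorem twistChart_extend_symm_add {w : EuclideanSpace ℝ (Fin m)} (hw : ‖w‖ ≤ 3 * D.ε) :
    (D.twistChart S).extend J ((D.chart.extend J).symm (D.center + w)) = D.center + S w := by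
  rw [D.twistChart_extend S (D.symm_add_mem_twistChart_source S hint hw),
    (D.chart.extend J).right_inv (D.add_mem_target_of_norm_le hw), twistAffine_center_add]

/-- The twisted chart has the same centre `u₀`. [folklore] -/
theorem twistChart_extend_self : (D.twistChart S).extend J q = D.center := by
  have h := D.twistChart_extend_symm_add S hint (w := 0) (by rw [norm_zero]; linarith [D.eps_pos])
  rwa [D.symm_add_zero, map_zero, add_zero] at h

/-- **The chart points of the twisted chart: `ψ'(w) = ψ(S⁻¹ w)`** (`‖w‖ ≤ 3ε`). [cite: MilnorHCobordism1965, Def. 3.1 (PDF p. 12)] -/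
theorem twistChart_extend_symm {w : EuclideanSpace ℝ (Fin m)} (hw : ‖w‖ ≤ 3 * D.ε) :
    ((D.twistChart S).extend J).symm (D.center + w) = (D.chart.extend J).symm (D.center + S.symm w) := by
  have hw' : ‖S.symm w‖ ≤ 3 * D.ε := by rwa [LinearIsometryEquiv.norm_map]
  have h1 := D.twistChart_extend_symm_add S hint hw'
  rw [LinearIsometryEquiv.apply_symm_apply] at h1
  rw [← h1]
  exact (D.twistChart S).extend_left_inv (I := J) (D.symm_add_mem_twistChart_source S hint hw')

/-- Under `hint`, the closed `3ε`-ball about `u₀` lies in the target of the twisted chart. [folklore] -/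
theorem closedBall_subset_twistChart_target :
    closedBall D.center (3 * D.ε) ⊆ ((D.twistChart S).extend J).target := by
  intro u hu
  have hw : ‖S.symm (u - D.center)‖ ≤ 3 * D.ε := by
    rw [LinearIsometryEquiv.norm_map, ← dist_eq_norm]; exact hu
  have h1 := D.twistChart_extend_symm_add S hint hw
  rw [LinearIsometryEquiv.apply_symm_apply, add_sub_cancel] at h1
  rw [← h1]
  exact ((D.twistChart S).extend J).map_source (by
    rw [OpenPartialHomeomorph.extend_source]; exact D.symm_add_mem_twistChart_source S hint hw)

variable (hS : ∀ u, S (milnorModelField D.k u) = milnorModelField D.k (S u))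
include hS

/-- **Milnor's box twisted by a symmetry of the model.**  For a linear isometry `S` with
`S ∘ F_k = F_k ∘ S`: the twisted chart, the same index and size; `f = f q + Q_k` and
`dφ̂' X = F_k` in the twisted centred coordinates `S (φ̂ - φ̂ q)`
(`Literature.Topology.FourManifolds.milnorQuadratic_map_of_comm`). [cite: MilnorHCobordism1965, Def. 3.1 (PDF p. 12)] -/
def twist : MilnorBox J f X q where
  chart := D.twistChart S
  k := D.k
  ε := D.ε
  mem_maximalAtlas := D.twistChart_mem_maximalAtlas S
  mem_source := D.mem_twistChart_source_self S hint
  eps_pos := D.eps_pos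
  closedBall_subset := by
    rw [D.twistChart_extend_self S hint]
    exact D.closedBall_subset_twistChart_target S hint
  apply_eq z hz := by
    rw [D.twistChart_extend_self S hint, D.twistChart_extend_sub_center S hz,
      milnorQuadratic_map_of_comm S hS, D.apply_eq z (D.twistChart_source_subset S hz)]
    rfl
  mfderiv_eq z hz := by
    have hz₁ : z ∈ D.chart.source := D.twistChart_source_subset S hz
    set Rc : EuclideanSpace ℝ (Fin m) →L[ℝ] EuclideanSpace ℝ (Fin m) :=
      (S.toContinuousLinearEquiv : EuclideanSpace ℝ (Fin m) →L[ℝ] EuclideanSpace ℝ (Fin m)) with hRc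
    have hRc' : ∀ v, Rc v = S v := fun v => rfl
    have h1 : (D.twistChart S).extend J =ᶠ[𝓝 z] ((fun u => S (u - D.center) + D.center) ∘ D.chart.extend J) :=
      Filter.eventuallyEq_of_mem ((D.twistChart S).open_source.mem_nhds hz) fun x hx => by
        rw [D.twistChart_extend S hx, comp_apply, twistAffine_apply]
    have hmd : MDifferentiableAt J 𝓘(ℝ, EuclideanSpace ℝ (Fin m)) (D.chart.extend J) z :=
      (D.chart.contMDiffAt_extend D.mem_maximalAtlas hz₁).mdifferentiableAt (by simp)
    have hB : HasFDerivAt (fun u => S (u - D.center) + D.center) Rc (D.chart.extend J z) := by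
      have hB' := ((Rc.hasFDerivAt).comp (D.chart.extend J z)
        ((hasFDerivAt_id (D.chart.extend J z)).sub_const D.center)).add_const D.center
      simp only [ContinuousLinearMap.comp_id] at hB'
      exact hB'
    have h2 : mfderiv J 𝓘(ℝ, EuclideanSpace ℝ (Fin m))
        ((fun u => S (u - D.center) + D.center) ∘ D.chart.extend J) z =
        Rc.comp (mfderiv J 𝓘(ℝ, EuclideanSpace ℝ (Fin m)) (D.chart.extend J) z) :=
      (hB.hasMFDerivAt.comp z hmd.hasMFDerivAt).mfderiv
    rw [h1.mfderiv_eq, h2, D.twistChart_extend_self S hint, D.twistChart_extend_sub_center S hz]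
    show Rc (mfderiv J 𝓘(ℝ, EuclideanSpace ℝ (Fin m)) (D.chart.extend J) z (X z)) = _
    rw [D.mfderiv_eq z hz₁, hRc', hS]
    rfl

/-- The chart of the twisted box. [folklore] -/
@[simp] theorem twist_chart : (D.twist S hint hS).chart = D.twistChart S := rfl

/-- The twisted box has the same index. [folklore] -/
@[simp] theorem twist_k : (D.twist S hint hS).k = D.k := rfl

/-- The twisted box has the same size. [folklore] -/
@[simp] theorem twist_ε : (D.twist S hint hS).ε = D.ε := rfl

/-- **The centred coordinates of the twisted box are `S` of the old ones.** [cite: MilnorHCobordism1965, Def. 3.1 (PDF p. 12)] -/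
theorem coord_twist {z : M} (hz : z ∈ (D.twistChart S).source) :
    (D.twist S hint hS).coord z = S (D.coord z) := by
  show (D.twistChart S).extend J z - (D.twistChart S).extend J q = _
  rw [D.twistChart_extend_self S hint, D.twistChart_extend_sub_center S hz]

/-- The twisted box has the same centre. [folklore] -/
theorem center_twist : (D.twist S hint hS).center = D.center :=
  D.twistChart_extend_self S hint

/-- **The chart points of the twisted box: `ψ'(w) = ψ(S⁻¹ w)`** (`‖w‖ ≤ 3ε`). [cite: MilnorHCobordism1965, Def. 3.1 (PDF p. 12)] -/
theorem twist_symm_add {w : EuclideanSpace ℝ (Fin m)} (hw : ‖w‖ ≤ 3 * D.ε) :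
    ((D.twist S hint hS).chart.extend J).symm ((D.twist S hint hS).chart.extend J q + w) =
      (D.chart.extend J).symm (D.chart.extend J q + S.symm w) := by
  show ((D.twistChart S).extend J).symm ((D.twistChart S).extend J q + w) = _
  rw [D.twistChart_extend_self S hint, D.twistChart_extend_symm S hint hw]

/-- Points `ψ w`, `‖w‖ ≤ 3ε`, lie in the source of the twisted box. [folklore] -/
theorem symm_add_mem_twist_source {w : EuclideanSpace ℝ (Fin m)} (hw : ‖w‖ ≤ 3 * D.ε) :
    (D.chart.extend J).symm (D.center + w) ∈ (D.twist S hint hS).chart.source :=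
  D.symm_add_mem_twistChart_source S hint hw

end Interior

end MilnorBox

end Literature.Topology.FourManifolds
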